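import Summits.ResolutionOfSingularities.ResolutionOfSingularities.Theorems.MarkedTransferCampaignW46MohWindowShadeFormalWalk
import Summits.ResolutionOfSingularities.ResolutionOfSingularities.Theorems.MarkedTransferCampaignW46MohWindowShadeFormalStatement
import Summits.ResolutionOfSingularities.ResolutionOfSingularities.Theorems.MarkedTransferCampaignW46MohWindowShadePolyTerminates
import Summits.ResolutionOfSingularities.ResolutionOfSingularities.Theorems.MarkedTransferCampaignW46MohWindowShadePolyWitness
import HarnessLib

/-!
# [OURS · L1 W4.6 rung (iii)] RUNG (iii) for the FORMALLY-POLYNOMIAL purely inseparable surface window, CLOSED BY NAME over algebraically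
# closed fields — `CampaignW46.MohWindowSurfaceFormalPolyPermissiblyTerminates p K` — and over every PERFECT field as long as the singular
# points stay rational; the Zariski-polynomial regime of gen 4 is a sub-regime

Cell `res-hironaka`, LADDER-RESOLUTION rung L (D-0089), slot W4.6 rung (iii) «purely inseparable `z^p = f(x, y)` with `ord f < 2p`»; seat
res-L1-s46-pv-6 (gen 5). Host route MarkedTransfer, `--supports stmt-ResolutionOfSingularities-16155 --as helper`; kind proof (no definition).

THE CLOSERS.
* `mohWindowSurfaceFormalPolyPermissiblyTerminates_of_isAlgClosed (p) (K) [IsAlgClosed K] : MohWindowSurfaceFormalPolyPermissiblyTerminates p K` —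
  there is NO infinite §2.1-permissible sequence of the typed Th. 16.6 procedure's ambient data all of whose stages lie in
  `Regime.mohWindowSurfaceFormalPoly` (o1's `regimeMohWindowSurfaceInsep` + at every singular point, in SOME Cohen coordinates,
  `J_ξ 𝒪̂_ξ = (z^p + F(u₀, u₁))` with `F ∈ K[y₀, y₁]` cleaned, `p < ord₀ F < 2p`) — res-D-pv-008 AS s46-pv-14's clause (R1), polynomial form;
  + typed forms `Terminates`/`TerminatesNabla` for every `N`, `Rd`. Assembly: `…MohWindowShadeFormalWalk.false_of_permissibleRun_insep_formalStart`.
* `mohWindowSurfaceFormalPoly_rationalSing_permissiblyTerminates (p) (K) [PerfectField K]` — over ANY PERFECT field: no infinite permissible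
  sequence inside `Regime.mohWindowSurfaceFormalPoly ∩ Regime.rationalSing` (singular points `K`-rational at every stage). This is what the proof
  uses of algebraic closedness: the thread points are then residually rational over their images (naturality of `germConst`).
* `MohWindowSurfacePolyAt.formalPolyAt` — gen 4's Zariski-polynomial presentation at a residually rational point IS a formally-polynomial one
  (adapted Cohen coordinates, gen 4's `exists_cohen_anchor` pattern with pv-2's recognition theorem); hence over algebraically closed `K`
  `Regime.mohWindowSurfacePoly ≤ Regime.mohWindowSurfaceFormalPoly` and gen 4's closer `mohWindowSurfacePolyPermissiblyTerminates_of_isAlgClosed` is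
  RE-DERIVED from the new one (`mohWindowSurfacePolyPermissiblyTerminates_of_formal`) — the formal rung is the stronger theorem.

WHAT IS NOT CLAIMED: o1's full rung `MohWindowSurfaceInsepPermissiblyTerminates` (its regime contains isolated window germs with NO formal purely
inseparable presentation, pv-14's H2-CENSUS item 8: those need the Weierstrass-shape model, conjecture (R3′)); power-series (non-polynomial) `F`;
non-rational singular points over perfect non-closed `K`; anything about the manuscript.
HONEST FRAMING. Nothing here is a statement of H. Hironaka's manuscript [Hironaka2017] (2017-03-23; Th. 16.6 p.84, Th. 16.13 p.87 — scope only,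
under adjudication) and nothing asserts that any statement of it holds. AI-written; AI review is weaker than expert review. No `sorry`; axioms
standard. [folklore]
-/

noncomputable section

set_option linter.dupNamespace false -- mandated namespace of this single-conjunct summit

open CategoryTheory AlgebraicGeometry TopologicalSpace IsLocalRing MvPolynomial

namespace Summit.ResolutionOfSingularities.ResolutionOfSingularities.Theorems

namespace CampaignW46

open CategoryTheory AlgebraicGeometry TopologicalSpace
open Literature.AlgebraicGeometry.Resolution
open Literature.AlgebraicGeometry.Resolution.Hauser2010
open Literature.AlgebraicGeometry.Hironaka2017.S02Preliminaries
open Literature.AlgebraicGeometry.Hironaka2017.Datum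
open Scheme.IdealSheafData

/-! ## §1 A Zariski-polynomial presentation at a residually rational point is a formally-polynomial one -/

section Cohen

variable {p : ℕ} {K : Type} [Field K] {R : Type} [CommRing R] [IsRegularLocalRing R]

/-- **Cohen coordinates adapted to a rational anchor, indexed `(z; u₀, u₁)`.** `R` regular local of embedding dimension `3`, `(x, y, z)`
generating `𝔪`, `κ : K → R` constants with `R` residually rational over `κ`: there is `E : R̂ ≅ K⟦z, u₀, u₁⟧` with `E(x) = u₀`, `E(y) = u₁`,
`E(z) = z` and `E(κ l) = C l` (gen 4's `MohWindowShadeAnchorExit.exists_cohen_anchor` with pv-2's `Option (Fin 2)` indexing; pv-2's recognition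
theorem `FormalChart.exists_ringEquiv_mvPowerSeries_of_generators`). [cite: Matsumura1987, Thm. 29.7] -/
theorem exists_cohen_anchor_option (h3 : (maximalIdeal R).spanFinrank = 3) {x y z : R} (hxyz : Ideal.span {x, y, z} = maximalIdeal R)
    (κ : K →+* R) (hκ : ∀ r : R, ∃ l : K, r - κ l ∈ maximalIdeal R) :
    ∃ E : AdicCompletion (maximalIdeal R) R ≃+* MvPowerSeries (Option (Fin 2)) K,
      E (algebraMap R _ x) = MvPowerSeries.X (some 0) ∧ E (algebraMap R _ y) = MvPowerSeries.X (some 1) ∧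
        E (algebraMap R _ z) = MvPowerSeries.X none ∧ ∀ c : K, E (algebraMap R _ (κ c)) = MvPowerSeries.C c := by
  classical
  set C := AdicCompletion (maximalIdeal R) R
  set ofR := algebraMap R C with hofR
  haveI : IsNoetherianRing C := isNoetherianRing_adicCompletion_maximalIdeal R
  have h𝔪C : maximalIdeal C = (maximalIdeal R).map ofR := AdicCompletion.maximalIdeal_eq_map
  -- residual rationality of the completion
  have hι : ∀ c : C, ∃ l : K, c - (ofR.comp κ) l ∈ maximalIdeal C := by
    intro c
    obtain ⟨rbar, hrbar⟩ := (AdicCompletion.residueField_map_bijective R).2 (IsLocalRing.residue _ c)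
    obtain ⟨r, rfl⟩ := IsLocalRing.residue_surjective rbar
    obtain ⟨l, hl⟩ := hκ r
    refine ⟨l, ?_⟩
    have h1 : c - ofR r ∈ maximalIdeal C := by
      rw [IsLocalRing.ResidueField.map_residue] at hrbar
      rw [← Ideal.Quotient.eq]
      exact hrbar.symm
    have h2 : ofR r - ofR (κ l) ∈ maximalIdeal C := by
      rw [← map_sub, h𝔪C]; exact Ideal.mem_map_of_mem _ hl
    have := Ideal.add_mem _ h1 h2
    rwa [RingHom.comp_apply, ← sub_add_sub_cancel c (ofR r) (ofR (κ l))]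
  -- the generators, indexed by `Option (Fin 2)`: `none ↦ z`, `some 0 ↦ x`, `some 1 ↦ y`
  set v : Option (Fin 2) → R := fun o => o.elim z (fun l => (![x, y] : Fin 2 → R) l) with hv
  have hgen : Ideal.span (Set.range fun o : Option (Fin 2) => ofR (v o)) = maximalIdeal C := by
    rw [h𝔪C, show Ideal.map ofR (maximalIdeal R) = Ideal.map ofR (Ideal.span {x, y, z}) by rw [hxyz], Ideal.map_span]
    congr 1
    ext c
    simp only [Set.mem_range, Set.mem_image, Set.mem_insert_iff, Set.mem_singleton_iff]
    constructor
    · rintro ⟨o, rfl⟩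
      rcases o with _ | l
      · exact ⟨z, Or.inr (Or.inr rfl), rfl⟩
      · have hl : l = 0 ∨ l = 1 := by fin_cases l <;> simp
        rcases hl with rfl | rfl
        · exact ⟨x, Or.inl rfl, rfl⟩
        · exact ⟨y, Or.inr (Or.inl rfl), rfl⟩
    · rintro ⟨r, hr, rfl⟩
      rcases hr with rfl | rfl | rfl
      · exact ⟨some 0, rfl⟩
      · exact ⟨some 1, rfl⟩
      · exact ⟨none, rfl⟩
  -- the dimension
  have hdim : ringKrullDim C = Fintype.card (Option (Fin 2)) := by
    rw [ringKrullDim_adicCompletion]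
    have h := IsRegularLocalRing.spanFinrank_maximalIdeal (R := R)
    rw [h3] at h
    simp only [Fintype.card_option, Fintype.card_fin]
    exact_mod_cast h.symm
  obtain ⟨E, hEX, hEC⟩ := FormalChart.exists_ringEquiv_mvPowerSeries_of_generators (ofR.comp κ) hι _ hgen hdim
  exact ⟨E, hEX (some 0), hEX (some 1), hEX none, fun c => hEC c⟩

/-- **Poly ⇒ FormalPoly at a residually rational point.** [OURS · L1 W4.6 rung (iii)] NOT a statement of the manuscript. Gen 4's
Zariski-polynomial presentation `MohWindowSurfacePolyAt p κ I` with constants `κ` over which `R` is residually rational gives a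
formally-polynomial presentation `MohWindowSurfaceFormalPolyAt p K R I` (same `F`; adapted Cohen coordinates). [cite: Matsumura1987, Thm. 29.7] -/
theorem MohWindowSurfacePolyAt.formalPolyAt {κ : K →+* R} (hκ : ∀ r : R, ∃ l : K, r - κ l ∈ maximalIdeal R) {I : Ideal R}
    (h : MohWindowSurfacePolyAt p κ I) : MohWindowSurfaceFormalPolyAt p K R I := by
  obtain ⟨hR, h3, x, y, z, hxyz, F, hclean, hpF, hF2, hI⟩ := h
  obtain ⟨E, hEx, hEy, hEz, hEC⟩ := exists_cohen_anchor_option h3 hxyz κ hκ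
  refine ⟨E, z ^ p + MvPolynomial.eval₂ κ ![x, y] F, 1, F, hclean, hpF, hF2, hI, isUnit_one, ?_⟩
  set φ : R →+* MvPowerSeries (Option (Fin 2)) K := (E : _ →+* MvPowerSeries (Option (Fin 2)) K).comp
    (algebraMap R (AdicCompletion (maximalIdeal R) R)) with hφ
  have hφa : ∀ r, φ r = E (algebraMap R _ r) := fun r => rfl
  rw [one_mul, ← hφa, map_add, map_pow, hφa z, hEz, MvPolynomial.eval₂_comp_left φ κ ![x, y] F]
  congr 1
  have hκ' : φ.comp κ = MvPowerSeries.C := RingHom.ext fun c => by rw [RingHom.comp_apply, hφa, hEC]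
  have hX' : (φ ∘ (![x, y] : Fin 2 → R)) = fun l : Fin 2 => if l = (0 : Fin 2) then MvPowerSeries.X (some (0 : Fin 2)) else MvPowerSeries.X (some 1) := by
    funext l
    rw [Function.comp_apply, hφa]
    fin_cases l
    · show E (algebraMap R _ x) = _
      rw [hEx]; simp
    · show E (algebraMap R _ y) = _
      rw [hEy]; simp
  rw [hκ', hX']

end Cohen

/-! ## §2 The closers -/

variable (p : ℕ) [Fact p.Prime] (K : Type) [Field K] [CharP K p]

/-- **No hit thread in the formally-polynomial surface window regime with rational singular points** (any PERFECT `K`). [OURS · L1 W4.6 rung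
(iii)] NOT a statement of the manuscript: along a hit thread the points are singular, hence `K`-rational, hence residually rational over their
images (`germConst` is natural under the blow-ups), and the root is formally anchored. [cite: StacksProject, Tag 0804] -/
theorem mohWindowSurfaceFormalPoly_rationalSing_noHitThread [PerfectField K] :
    NoHitThread (Regime.inter (Regime.mohWindowSurfaceFormalPoly (p := p) (K := K)) Regime.rationalSing) := by
  classical
  haveI : PerfectRing K p := PerfectField.toPerfectRing p
  intro r hr t
  obtain ⟨e, f₀, w, F, hclean, -, -, hJ, hw, hE⟩ := (hr 0).1.2 (t.y 0) (t.mem 0)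
  refine MohWindowShadeFormalWalk.false_of_hitThread_formalAnchor r (fun k => (hr k).1.1) t (fun k y => ?_) F hclean ⟨e, f₀, w, hJ, hw, hE⟩
  -- rationality of the singular point `y (k+1)` and naturality of the constants
  obtain ⟨l, hl⟩ := (hr (k + 1)).2 (t.y (k + 1)) (t.mem (k + 1)) y
  refine ⟨germConst (r.A k) ((r.π k).base (t.y (k + 1))) l, ?_⟩
  have hnat : ((r.π k).stalkMap (t.y (k + 1))).hom (germConst (r.A k) ((r.π k).base (t.y (k + 1))) l) =
      germConst (r.A (k + 1)) (t.y (k + 1)) l :=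
    MohWindowShadeAnchorWalk.stalkMap_germ_sectionConst (r.π k) (r.hom_eq k) (t.y (k + 1)) l
  rw [hnat]
  exact hl

/-- **RUNG (iii), FORMALLY-POLYNOMIAL WINDOW WITH RATIONAL SINGULAR POINTS, over EVERY PERFECT FIELD.** [OURS · L1 W4.6 rung (iii)] NOT a
statement of the manuscript: no infinite §2.1-permissible sequence all of whose stages lie in `Regime.mohWindowSurfaceFormalPoly` and have
`K`-rational singular points. [cite: Hauser2010, §F (setting f = x^p + y^r g)] [cite: StacksProject, Tag 0804] -/
theorem mohWindowSurfaceFormalPoly_rationalSing_permissiblyTerminates [PerfectField K] :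
    PermissiblyTerminates (Regime.inter (Regime.mohWindowSurfaceFormalPoly (p := p) (K := K)) Regime.rationalSing) :=
  permissiblyTerminates_of_noHitThread (fun A E h => ((regimeMohWindowSurfaceInsep_iff A E).mp h.1.1).1.1)
    (mohWindowSurfaceFormalPoly_rationalSing_noHitThread p K)

/-- **No hit thread in the formally-polynomial surface window regime** (algebraically closed `K`). [OURS · L1 W4.6 rung (iii)] NOT a statement
of the manuscript. [cite: StacksProject, Tag 0CY7] -/
theorem mohWindowSurfaceFormalPoly_noHitThread [IsAlgClosed K] : NoHitThread (Regime.mohWindowSurfaceFormalPoly (p := p) (K := K)) := by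
  classical
  intro r hr t
  refine MohWindowShadeFormalWalk.false_of_permissibleRun_insep_formalStart r (fun k => (hr k).1) fun ξ hξ => ?_
  obtain ⟨e, f₀, w, F, hclean, -, -, hJ, hw, hE⟩ := (hr 0).2 ξ hξ
  exact ⟨e, f₀, w, F, hclean, hJ, hw, hE⟩

/-- **RUNG (iii), FORMALLY-POLYNOMIAL PURELY INSEPARABLE SURFACE WINDOW — CLOSED BY NAME over algebraically closed fields.** [OURS · L1 W4.6
rung (iii)] NOT a statement of the manuscript: `MohWindowSurfaceFormalPolyPermissiblyTerminates p K` — no infinite §2.1-permissible sequence inside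
`Regime.mohWindowSurfaceFormalPoly`. [cite: Hauser2010, §F (setting f = x^p + y^r g)] [cite: StacksProject, Tag 0CY7] -/
theorem mohWindowSurfaceFormalPolyPermissiblyTerminates_of_isAlgClosed [IsAlgClosed K] : MohWindowSurfaceFormalPolyPermissiblyTerminates p K :=
  permissiblyTerminates_of_noHitThread (fun A E h => ((regimeMohWindowSurfaceInsep_iff A E).mp h.1).1.1)
    (mohWindowSurfaceFormalPoly_noHitThread p K)

/-- **The typed rungs**: over an algebraically closed field, for EVERY notion instance `N` and reading `Rd`, the typed Th. 16.6 procedure with the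
literal centre rule (`Terminates`) and the ∇-centred one (`TerminatesNabla`) have no infinite run inside `Regime.mohWindowSurfaceFormalPoly`.
[OURS · L1 W4.6 rung (iii)] NOT a statement of the manuscript. [folklore] -/
theorem terminates_mohWindowSurfaceFormalPoly_of_isAlgClosed [IsAlgClosed K] (n : ℕ) (N : Notions.{0} n) (Rd : Reading p K N) :
    Terminates N Rd (Regime.mohWindowSurfaceFormalPoly (p := p) (K := K)) ∧
      TerminatesNabla N Rd (Regime.mohWindowSurfaceFormalPoly (p := p) (K := K)) :=
  terminates_and_terminatesNabla_of_mohWindowSurfaceFormalPolyPermissiblyTerminates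
    (mohWindowSurfaceFormalPolyPermissiblyTerminates_of_isAlgClosed p K) n N Rd

/-! ## §3 The Zariski-polynomial regime of gen 4 is a sub-regime (algebraically closed `K`) -/

/-- **Poly ≤ FormalPoly** over an algebraically closed field (closed singular points are residually rational over the constants). [OURS · L1 W4.6
rung (iii)] NOT a statement of the manuscript. [cite: StacksProject, Tag 0CY7] -/
theorem Regime.mohWindowSurfacePoly_le_formalPoly [IsAlgClosed K] (A : AmbientDatum p K) (E : IdealExponent A.Z)
    (h : Regime.mohWindowSurfacePoly A E) : Regime.mohWindowSurfaceFormalPoly A E := by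
  refine ⟨h.1, fun ξ hξ => ?_⟩
  obtain ⟨hR, -, hcl, -, -⟩ := MohWindowShadeAnchorWalk.regime_point h.1 hξ
  haveI := hR
  exact (h.2 ξ hξ).formalPolyAt (MohWindowShadeAnchorWalk.exists_sub_germ_sectionConst_mem A hcl)

/-- **Gen 4's closer re-derived from the formal rung** (the formal rung is the stronger theorem). [OURS · L1 W4.6 rung (iii)] NOT a statement of
the manuscript. [folklore] -/
theorem mohWindowSurfacePolyPermissiblyTerminates_of_formal [IsAlgClosed K] (h : MohWindowSurfaceFormalPolyPermissiblyTerminates p K) :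
    MohWindowSurfacePolyPermissiblyTerminates p K :=
  permissiblyTerminates_antitone (fun A E hAE => Regime.mohWindowSurfacePoly_le_formalPoly p K A E hAE) h

/-- **NON-VACUITY of the formally-polynomial regime** (algebraically closed `K`): gen 4's kernel witness `((z^p + x^(p+1) + y^(p+1))·𝒪, p)` on `𝔸³_K`
(`…MohWindowShadePolyWitness`, p522062) is a standard state of `Regime.mohWindowSurfaceFormalPoly` with non-empty singular locus — the rung is not
about the empty set. [OURS · L1 W4.6 rung (iii)] NOT a statement of the manuscript. [folklore] -/
theorem exists_singular_state_mohWindowSurfaceFormalPoly [IsAlgClosed K] :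
    ∃ (A : AmbientDatum p K) (E : IdealExponent A.Z),
      Regime.mohWindowSurfaceFormalPoly (p := p) (K := K) A E ∧ E.IsStandard ∧ E.sing.Nonempty := by
  obtain ⟨A, E, hRg, hst, hne⟩ := MohWindowShadePolyWitness.exists_singular_state_mohWindowSurfacePoly p K
  exact ⟨A, E, Regime.mohWindowSurfacePoly_le_formalPoly p K A E hRg, hst, hne⟩

end CampaignW46

end Summit.ResolutionOfSingularities.ResolutionOfSingularities.Theorems

end
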